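import Literature.Analysis.FluidPDE.MikadoPrincipalParts
import Literature.Analysis.FluidPDE.DuchonRobertPressure
import Literature.Analysis.FluidPDE.Antidivergence
import Literature.Analysis.FunctionSpaces.TorusClassicalNSUniqueness
import HarnessLib

/-!
# The heat residual of one Coiculescu–Palasek level: `R_k`, the heat defect, and
# `(∂ₜ - Δ) v_k = div (∂ₜ - Δ) R_k` (the tensor `F₁` of Prop. 4.1 at the block level)

Analysis/FluidPDE support file (definitions with proved API; no named facts) on the discharge path of
the principal-parts hypothesis `hA` of
`Literature.Barriers.NavierStokesRegularity.CriticalDataSmoothNonuniqueness_of_principalParts_of_perturbationLe`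
(M. P. Coiculescu, S. Palasek, Invent. Math. 244 (2025), arXiv:2503.14699). Prop. 4.1 (proof):
"`R_k ≔ φ_k ∗ 𝒟 ∑_j a_{j,k} Ψ_{j,k}` … constructed so that `ℙ div R_k = v_k`", "`F₁⁽¹⁾ = -∑_{k even}(∂ₜ - Δ)R_k`",
"the heat operator exactly annihilates the `sin(N_k(x-x_j)·η_j) exp(-|η_j|²N_k²t)` factor within `Ψ_{j,k}`;
thus one is left with the remaining terms from the Laplacian". Here, for the data `I : CP25.IterData`
(`h : I.Admissible`) and every level `k`:

* `CP25.IterData.apsi k j = a_{j,k} Ψ⁰_{j,k}`, `Rtensor k j = k_{ℓ_k} ⋆ 𝒟(a_{j,k}Ψ⁰_{j,k})` (so that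
  `R_k(t) = ∑_j e^{-rate_{k,j}t} Rtensor k j`), and **`Vfield_eq_tensorDiv_Rtensor`**: `V_{j,k} = div (Rtensor k j)`
  — `div 𝒟 = curl curl` (`CP25.sum_partialDeriv_dTensor_eq_curl_curl`) and `div` commutes with the mollifier;
  hence `vHeat_eq_tensorDiv` : `v_k(t) = div R_k(t)` EXACTLY (no Leray projector needed);
* `CP25.IterData.heatDefect k j = -rate_{k,j} a_{j,k}Ψ⁰_{j,k} - Δ(a_{j,k}Ψ⁰_{j,k})` (the field left over when
  `∂ₜ - Δ` acts on `e^{-rate t} a Ψ⁰`), `heatDefectTensor k j = k_{ℓ_k} ⋆ 𝒟(heatDefect k j)` and the block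
  tensor `heatResidual k t = -∑_j e^{-rate t} heatDefectTensor k j` (`= F₁` restricted to level `k`);
* **`tensorDiv_heatDefectTensor`**: `div (k_ℓ ⋆ 𝒟 heatDefect) = -rate V_{j,k} - Δ V_{j,k}`, hence
  **`tensorDiv_heatResidual`**: `div (heatResidual k t) = -(∂ₜ v_k(t) - Δ v_k(t))` pointwise, with `∂ₜ v_k`
  in the form of `CP25.IterData.blockDt` (`MikadoSpaceTime`) and `Δ v_k(t) = ∑_j e^{-rate t} ΔV_{j,k}`
  (`laplacian_vHeat`);
* symmetry of these tensors, smoothness, and crude all-orders `HasLiftDerivBounds` for `heatDefect`,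
  `heatDefectTensor` (amplitude `∝ N_k`, frequency `κ_{n+2}N_k`; the sharp `∝ M_k` bound exhibiting the
  cancellation `-Δ sin = rate · sin` is the business of the estimate file).

## Mathlib / tree search

Tree: `CP25.dTensor`, `dTensor_symm`, `sum_partialDeriv_dTensor_eq_curl_curl`, `dTensor_kernel_convolution`
(`SymmetrizedGradientTensor`, `MikadoDataStep`), `tensorDiv` (`LerayTensorHolder`), `Torus.partialDeriv_convolution`,
`FunctionSpaces.Torus.laplacian_convolution`, `FunctionSpaces.Torus.convolution_finset_sum_right` (`TorusConvolution`), `partialDeriv_laplacian`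
(`TorusPressurePoisson`), `laplacian_apply_coord` (`DuchonRobertPressure`), `laplacian_sub` (`TorusClassicalNSUniqueness`),
`BDSV.curl_const_smul`, `curl_sub`, `curl_curl`, the block API of `MikadoHeatBlocks`.

## On the hypothesis `h : I.Admissible`

`CP25.IterData.Admissible I` (a `structure … : Prop` of `MikadoDataIteration`) bundles the standing
HYPOTHESES on the abstract inputs `I` (profile bounds, unit phases, positive averages, scale relations,
cut-off bounds); the theorems below take `h : I.Admissible` as a section hypothesis (`variable … include h`).
It is not a named fact and nothing here assumes a conclusion: the predicate is PROVED for the paper's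
concrete inputs in `CP25.admissible_mkIter` (`MikadoInputs`), which is how these theorems are used.

## References

* M. P. Coiculescu, S. Palasek, Invent. Math. 244 (2025) 165–219, doi:10.1007/s00222-025-01396-z,
  arXiv:2503.14699: Def. 3.10, Rmk. 3.11, §4.1 (Prop. 4.1, the tensors `R_k`, `F₁`). [CoiculescuPalasek2025]
-/

noncomputable section

open MeasureTheory Set Filter Function
open _root_.Topology
open scoped BigOperators ContDiff ENNReal Convolution

namespace Literature.Analysis.FluidPDE

namespace CP25

open Literature.Analysis.FunctionSpaces Literature.Analysis.FunctionSpaces.Torus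

/-! ## Generic: the divergence of a mollified symmetrized gradient; Laplacian commutations -/

section Generic

variable {ℓ : ℝ}

/-- **`div (k_ℓ ⋆ 𝒟 g) = k_ℓ ⋆ curl curl g`** for smooth `g` (`div 𝒟 = curl curl`, and the mollifier commutes
with derivatives). [cite: CoiculescuPalasek2025, Rmk. 3.11 ("`v_k = div 𝒟ψ_k`")] -/
theorem tensorDiv_kernel_dTensor {g : UnitAddTorus (Fin 3) → EuclideanSpace ℝ (Fin 3)} (hg : IsSmooth g)
    (hℓ : 0 < ℓ) (hℓ' : ℓ ≤ 1 / 4) :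
    tensorDiv (kernel ℓ ⋆ dTensor g) = kernel ℓ ⋆ BDSV.curl (BDSV.curl g) := by
  have hκi := (isSmooth_kernel (d := Fin 3) hℓ hℓ').integrable
  have hDe : ∀ a b, IsSmooth (fun y => dTensor g y a b) := fun a b => isSmooth_dTensor_entry hg a b
  have hDs : IsSmooth (dTensor g) := contDiff_pi.2 fun a => contDiff_pi.2 fun b => hDe a b
  have hDc : Continuous (dTensor g) := hDs.continuous
  have hcc : IsSmooth (BDSV.curl (BDSV.curl g)) := BDSV.isSmooth_curl (BDSV.isSmooth_curl hg)
  funext x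
  ext i
  rw [tensorDiv_apply, kernel_convolution_vec_apply hℓ hℓ' hcc.continuous x i]
  -- entries of the mollified tensor are mollified entries
  have hent : ∀ j, (fun y => (kernel ℓ ⋆ dTensor g) y i j) = kernel ℓ ⋆ fun y => dTensor g y i j := by
    intro j; funext y; exact kernel_convolution_tensor_apply hℓ hℓ' hDc y i j
  simp_rw [hent]
  have hpd : ∀ j, Torus.partialDeriv j (kernel ℓ ⋆ fun y => dTensor g y i j) x =
      (kernel ℓ ⋆ Torus.partialDeriv j (fun y => dTensor g y i j)) x :=
    fun j => FunctionSpaces.Torus.partialDeriv_convolution hκi (hDe i j) j x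
  simp_rw [hpd]
  rw [← FunctionSpaces.Torus.convolution_finset_sum_right hκi Finset.univ (fun j _ => ((hDe i j).partialDeriv j).continuous) x]
  congr 1
  funext y
  exact sum_partialDeriv_dTensor_eq_curl_curl hg y i

/-- `Δ` commutes with the coordinate partial derivatives of a vector field:
`Δ(y ↦ ∂_k v_i(y)) = ∂_k (Δv)_i`. [folklore] -/
theorem laplacian_partialDeriv_coord {v : UnitAddTorus (Fin 3) → EuclideanSpace ℝ (Fin 3)} (hv : IsSmooth v)
    (k i : Fin 3) (x : UnitAddTorus (Fin 3)) :
    Torus.laplacian (fun y => Torus.partialDeriv k v y i) x = Torus.partialDeriv k (fun y => Torus.laplacian v y) x i := by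
  have hL := hv.laplacian
  rw [show (fun y => Torus.partialDeriv k v y i) = Torus.partialDeriv k (fun z => v z i) from
      funext fun y => (partialDeriv_apply_coord (hv.isContDiff (by simp)) k y i).symm,
    ← Torus.partialDeriv_laplacian (hv.apply i) k x, ← partialDeriv_apply_coord (hL.isContDiff (by simp)) k x i]
  congr 1
  funext y
  exact (Torus.laplacian_apply_coord hv y i).symm

/-- The Laplacian of a vector field commutes with `curl`. [folklore] -/
theorem laplacian_curl {v : UnitAddTorus (Fin 3) → EuclideanSpace ℝ (Fin 3)} (hv : IsSmooth v) (x : UnitAddTorus (Fin 3)) :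
    Torus.laplacian (BDSV.curl v) x = BDSV.curl (fun y => Torus.laplacian v y) x := by
  have hc := BDSV.isSmooth_curl hv
  have hP : ∀ k i, IsSmooth (fun y => Torus.partialDeriv k v y i) := fun k i => (hv.partialDeriv k).apply i
  have hcoord : ∀ (a k i k' i' : Fin 3), (fun y => BDSV.curl v y a) = (fun y => Torus.partialDeriv k v y i - Torus.partialDeriv k' v y i') →
      Torus.laplacian (BDSV.curl v) x a =
        Torus.partialDeriv k (fun y => Torus.laplacian v y) x i - Torus.partialDeriv k' (fun y => Torus.laplacian v y) x i' := by
    intro a k i k' i' hfun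
    rw [Torus.laplacian_apply_coord hc x a, hfun,
      show (fun y => Torus.partialDeriv k v y i - Torus.partialDeriv k' v y i') =
        (fun y => Torus.partialDeriv k v y i) - (fun y => Torus.partialDeriv k' v y i') from rfl,
      laplacian_sub (hP k i) (hP k' i'), Pi.sub_apply, laplacian_partialDeriv_coord hv, laplacian_partialDeriv_coord hv]
  have e0 := hcoord 0 1 2 2 1 (funext fun y => BDSV.curl_apply_zero v y)
  have e1 := hcoord 1 2 0 0 2 (funext fun y => BDSV.curl_apply_one v y)
  have e2 := hcoord 2 0 1 1 0 (funext fun y => BDSV.curl_apply_two v y)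
  ext a
  fin_cases a
  · simpa [BDSV.curl_apply_zero] using e0
  · simpa [BDSV.curl_apply_one] using e1
  · simpa [BDSV.curl_apply_two] using e2

/-- `Δ(curl curl v) = curl curl (Δv)`. [folklore] -/
theorem laplacian_curl_curl {v : UnitAddTorus (Fin 3) → EuclideanSpace ℝ (Fin 3)} (hv : IsSmooth v) (x : UnitAddTorus (Fin 3)) :
    Torus.laplacian (BDSV.curl (BDSV.curl v)) x = BDSV.curl (BDSV.curl fun y => Torus.laplacian v y) x := by
  rw [laplacian_curl (BDSV.isSmooth_curl hv)]
  congr 1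
  funext y
  exact laplacian_curl hv y

/-- `Δ(f + g) = Δf + Δg` pointwise for smooth `f`, `g`. [folklore] -/
theorem laplacian_add_apply {F : Type*} [NormedAddCommGroup F] [NormedSpace ℝ F]
    {f g : UnitAddTorus (Fin 3) → F} (hf : IsSmooth f) (hg : IsSmooth g) (x : UnitAddTorus (Fin 3)) :
    Torus.laplacian (fun y => f y + g y) x = Torus.laplacian f x + Torus.laplacian g x := by
  rw [show (fun y => f y + g y) = f + g from rfl, laplacian_eq_sum_partialDeriv_partialDeriv (hf.add hg),
    laplacian_eq_sum_partialDeriv_partialDeriv hf, laplacian_eq_sum_partialDeriv_partialDeriv hg, ← Finset.sum_add_distrib]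
  refine Finset.sum_congr rfl fun m _ => ?_
  have h1 : Torus.partialDeriv m (f + g) = fun y => Torus.partialDeriv m f y + Torus.partialDeriv m g y :=
    funext fun y => Torus.partialDeriv_add_apply (hf.isContDiff (by simp)) (hg.isContDiff (by simp)) m y
  rw [h1, Torus.partialDeriv_add_apply ((hf.partialDeriv m).isContDiff (by simp)) ((hg.partialDeriv m).isContDiff (by simp))]

/-- `Δ(c • f) = c • Δf` pointwise for smooth `f`. [folklore] -/
theorem laplacian_const_smul_apply {F : Type*} [NormedAddCommGroup F] [NormedSpace ℝ F]
    {f : UnitAddTorus (Fin 3) → F} (hf : IsSmooth f) (c : ℝ) (x : UnitAddTorus (Fin 3)) :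
    Torus.laplacian (fun y => c • f y) x = c • Torus.laplacian f x := by
  rw [show (fun y => c • f y) = c • f from rfl, laplacian_eq_sum_partialDeriv_partialDeriv (hf.smul c),
    laplacian_eq_sum_partialDeriv_partialDeriv hf, Finset.smul_sum]
  refine Finset.sum_congr rfl fun m _ => ?_
  have h1 : Torus.partialDeriv m (c • f) = fun y => c • Torus.partialDeriv m f y :=
    funext fun y => Torus.partialDeriv_const_smul_at (hf.isContDiff (by simp)) c m y
  rw [h1, Torus.partialDeriv_const_smul_at ((hf.partialDeriv m).isContDiff (by simp))]

/-- The Laplacian of a finite sum of smooth fields with scalar weights. [folklore] -/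
theorem laplacian_finset_sum_smul {ι : Type*} {F : Type*} [NormedAddCommGroup F] [NormedSpace ℝ F]
    (s : Finset ι) (c : ι → ℝ) {f : ι → UnitAddTorus (Fin 3) → F} (hf : ∀ i ∈ s, IsSmooth (f i)) (x : UnitAddTorus (Fin 3)) :
    Torus.laplacian (fun y => ∑ i ∈ s, c i • f i y) x = ∑ i ∈ s, c i • Torus.laplacian (f i) x := by
  classical
  induction s using Finset.induction_on generalizing x with
  | empty =>
    simp only [Finset.sum_empty]
    rw [laplacian_eq_sum_partialDeriv_partialDeriv (isSmooth_const (0 : F))]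
    have h0 : ∀ m, Torus.partialDeriv m (fun _ : UnitAddTorus (Fin 3) => (0 : F)) = fun _ => 0 :=
      fun m => funext fun y => Torus.partialDeriv_const_apply _ m y
    simp [h0]
  | @insert a s ha ih =>
    have hfa : IsSmooth (f a) := hf a (Finset.mem_insert_self a s)
    have hfs : ∀ i ∈ s, IsSmooth (f i) := fun i hi => hf i (Finset.mem_insert_of_mem hi)
    simp only [Finset.sum_insert ha]
    have hsm : IsSmooth (fun y => ∑ i ∈ s, c i • f i y) :=
      Torus.isSmooth_finset_sum s fun i hi => (hfs i hi).smul (c i)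
    rw [laplacian_add_apply (f := fun y => c a • f a y) (hfa.smul (c a)) hsm, ih hfs, laplacian_const_smul_apply hfa]

end Generic



/-! ## The heat residual of level `k` -/

namespace IterData

variable (I : IterData)

/-- `a_{j,k} Ψ⁰_{j,k}` — the `j`-th summand of the pre-mollified potential `g_k`. [cite: CoiculescuPalasek2025, Def. 3.5] -/
def apsi (k : ℕ) (j : Fin 6) (x : UnitAddTorus (Fin 3)) : EuclideanSpace ℝ (Fin 3) := I.amp k j x • I.pipe k j x

/-- `k_{ℓ_k} ⋆ 𝒟(a_{j,k}Ψ⁰_{j,k})`, the `j`-th summand of `R_k(0)`; `R_k(t) = ∑_j e^{-rate_{k,j}t} Rtensor k j`.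
[cite: CoiculescuPalasek2025, Prop. 4.1 (proof, definition of `R_k`)] -/
def Rtensor (k : ℕ) (j : Fin 6) : UnitAddTorus (Fin 3) → (Fin 3 → Fin 3 → ℝ) := kernel (I.ℓ k) ⋆ dTensor (I.apsi k j)

/-- `R_k(t) = k_{ℓ_k} ⋆ 𝒟 ∑_j a_{j,k}Ψ_{j,k}(t) = ∑_j e^{-rate t} Rtensor k j`. [cite: CoiculescuPalasek2025, Prop. 4.1 (proof)] -/
def Rheat (k : ℕ) (t : ℝ) (x : UnitAddTorus (Fin 3)) : Fin 3 → Fin 3 → ℝ :=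
  ∑ j, Real.exp (-(I.rate k j * t)) • I.Rtensor k j x

/-- **The heat defect** `(-rate_{k,j} - Δ)(a_{j,k}Ψ⁰_{j,k})`: what is left when the heat operator acts on
`e^{-rate t} a_{j,k}Ψ⁰_{j,k}` (the Laplacian falling on `a_{j,k}φ̃_j` and the cross terms; the sine factor is
annihilated). [cite: CoiculescuPalasek2025, Prop. 4.1 (proof of the `F₁` bound)] -/
def heatDefect (k : ℕ) (j : Fin 6) (x : UnitAddTorus (Fin 3)) : EuclideanSpace ℝ (Fin 3) :=
  -(I.rate k j) • I.apsi k j x - Torus.laplacian (I.apsi k j) x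

/-- `k_{ℓ_k} ⋆ 𝒟(heatDefect k j)`. [cite: CoiculescuPalasek2025, Prop. 4.1 (proof)] -/
def heatDefectTensor (k : ℕ) (j : Fin 6) : UnitAddTorus (Fin 3) → (Fin 3 → Fin 3 → ℝ) :=
  kernel (I.ℓ k) ⋆ dTensor (I.heatDefect k j)

/-- **`F₁` at level `k`**: `-(∂ₜ - Δ)R_k(t) = -∑_j e^{-rate t} k_ℓ ⋆ 𝒟((-rate - Δ)(aΨ⁰))`.
[cite: CoiculescuPalasek2025, Prop. 4.1 (`F₁⁽¹⁾ = -∑(∂ₜ-Δ)R_k`)] -/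
def heatResidual (k : ℕ) (t : ℝ) (x : UnitAddTorus (Fin 3)) : Fin 3 → Fin 3 → ℝ :=
  -∑ j, Real.exp (-(I.rate k j * t)) • I.heatDefectTensor k j x

namespace Admissible

variable {I} (h : I.Admissible)
include h

/-! ### Smoothness and bounds -/

/-- `aΨ⁰` in the currency (= `hasLiftDerivBounds_amp_smul_pipe`). [cite: CoiculescuPalasek2025, Prop. 3.7] -/
theorem hasLiftDerivBounds_apsi (n k : ℕ) (j : Fin 6) :
    HasLiftDerivBounds n (I.apsi k j) (3 * I.cst.Camp n * I.cst.G n * ((I.N k : ℝ))⁻¹) (I.cst.κ n * I.N k) :=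
  h.hasLiftDerivBounds_amp_smul_pipe n k j

/-- `aΨ⁰` is smooth. [folklore] -/
theorem isSmooth_apsi (k : ℕ) (j : Fin 6) : IsSmooth (I.apsi k j) := (h.hasLiftDerivBounds_apsi 0 k j).isSmooth

omit h in
/-- The Laplacian in the currency: `HasLiftDerivBounds n (Δf) (3CL²) L` from order `n+2` bounds. [folklore] -/
theorem hasLiftDerivBounds_laplacian' {F : Type*} [NormedAddCommGroup F] [NormedSpace ℝ F]
    {f : UnitAddTorus (Fin 3) → F} {C L : ℝ} {n : ℕ} (hf : HasLiftDerivBounds (n + 2) f C L) (hL : 0 ≤ L) :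
    HasLiftDerivBounds n (Torus.laplacian f) (3 * (C * L ^ 2)) L := by
  have hfun : Torus.laplacian f = fun y => ∑ m : Fin 3, Torus.partialDeriv m (Torus.partialDeriv m f) y :=
    funext (laplacian_eq_sum_partialDeriv_partialDeriv hf.isSmooth)
  rw [hfun]
  have hterm : ∀ m ∈ (Finset.univ : Finset (Fin 3)),
      HasLiftDerivBounds n (Torus.partialDeriv m (Torus.partialDeriv m f)) (C * L ^ 2) L := by
    intro m _
    have h1 := (hf.partialDeriv m).partialDeriv m
    rwa [show C * L * L = C * L ^ 2 by ring] at h1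
  have hs := HasLiftDerivBounds.sum Finset.univ hterm hL
  simpa [Finset.sum_const, Finset.card_univ, Fintype.card_fin] using hs

omit h in
/-- `0 ≤ κ_n N_k`-type frequencies are nonnegative under admissibility. [folklore] -/
private theorem freq_nonneg (h : I.Admissible) (n k : ℕ) : 0 ≤ I.cst.κ n * I.N k := by
  have := (h.κ_pos n).le; have := (h.N_pos' k).le; positivity

/-- **Crude all-orders bounds of the heat defect**: `HasLiftDerivBounds n (heatDefect k j) (C_hd) (κ_{n+2}N_k)` with
`C_hd = (rate + 3(κ_{n+2}N_k)²) · 3 Camp_{n+2} G_{n+2} / N_k` (no cancellation used; for summability only).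
[cite: CoiculescuPalasek2025, Prop. 4.1 (proof)] -/
theorem hasLiftDerivBounds_heatDefect (n k : ℕ) (j : Fin 6) :
    HasLiftDerivBounds n (I.heatDefect k j)
      ((I.rate k j + 3 * (I.cst.κ (n + 2) * I.N k) ^ 2) * (3 * I.cst.Camp (n + 2) * I.cst.G (n + 2) * ((I.N k : ℝ))⁻¹))
      (I.cst.κ (n + 2) * I.N k) := by
  have hL := freq_nonneg h (n + 2) k
  have ha := h.hasLiftDerivBounds_apsi (n + 2) k j
  have h1 := (ha.of_le (by omega : n ≤ n + 2)).const_smul (-(I.rate k j))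
  have h2 := hasLiftDerivBounds_laplacian' ha hL
  have h12 := h1.sub h2
  refine h12.mono (le_of_eq ?_) hL le_rfl
  rw [abs_neg, abs_of_nonneg (I.rate_nonneg k j)]
  ring

/-- The heat defect is smooth. [folklore] -/
theorem isSmooth_heatDefect (k : ℕ) (j : Fin 6) : IsSmooth (I.heatDefect k j) :=
  (h.hasLiftDerivBounds_heatDefect 0 k j).isSmooth

/-- **Bounds of `k_ℓ ⋆ 𝒟(heatDefect)`** (one more derivative, then mollify). [cite: CoiculescuPalasek2025, Prop. 4.1 (proof)] -/
theorem hasLiftDerivBounds_heatDefectTensor (n k : ℕ) (j : Fin 6) :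
    HasLiftDerivBounds n (I.heatDefectTensor k j)
      (8 * ((I.rate k j + 3 * (I.cst.κ (n + 3) * I.N k) ^ 2) * (3 * I.cst.Camp (n + 3) * I.cst.G (n + 3) * ((I.N k : ℝ))⁻¹) *
        (I.cst.κ (n + 3) * I.N k)))
      (I.cst.κ (n + 3) * I.N k) := by
  have hL := freq_nonneg h (n + 3) k
  have hd := h.hasLiftDerivBounds_heatDefect (n + 1) k j
  exact (hasLiftDerivBounds_dTensor hd hL).kernel_convolution (h.ℓ_pos k) (h.ℓ_le k)

/-- `k_ℓ ⋆ 𝒟(heatDefect)` is smooth. [folklore] -/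
theorem isSmooth_heatDefectTensor (k : ℕ) (j : Fin 6) : IsSmooth (I.heatDefectTensor k j) :=
  (h.hasLiftDerivBounds_heatDefectTensor 0 k j).isSmooth

/-- `Rtensor k j` is smooth. [folklore] -/
theorem isSmooth_Rtensor (k : ℕ) (j : Fin 6) : IsSmooth (I.Rtensor k j) :=
  ((hasLiftDerivBounds_dTensor (h.hasLiftDerivBounds_apsi 1 k j) (freq_nonneg h 1 k)).kernel_convolution
    (h.ℓ_pos k) (h.ℓ_le k)).isSmooth

/-! ### Symmetry -/

omit h in
/-- Mollified symmetrized gradients are symmetric. [cite: CoiculescuPalasek2025, Rmk. 3.11] -/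
theorem kernel_dTensor_symm {g : UnitAddTorus (Fin 3) → EuclideanSpace ℝ (Fin 3)} (hg : IsSmooth g) {ℓ : ℝ}
    (hℓ : 0 < ℓ) (hℓ' : ℓ ≤ 1 / 4) (x : UnitAddTorus (Fin 3)) (a b : Fin 3) :
    (kernel ℓ ⋆ dTensor g) x a b = (kernel ℓ ⋆ dTensor g) x b a := by
  have hDs : IsSmooth (dTensor g) := contDiff_pi.2 fun a => contDiff_pi.2 fun b => isSmooth_dTensor_entry hg a b
  have hDc : Continuous (dTensor g) := hDs.continuous
  rw [kernel_convolution_tensor_apply hℓ hℓ' hDc x a b, kernel_convolution_tensor_apply hℓ hℓ' hDc x b a]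
  congr 1
  funext y
  exact dTensor_symm g y a b

/-- `Rtensor` is symmetric. [cite: CoiculescuPalasek2025, Rmk. 3.11] -/
theorem Rtensor_symm (k : ℕ) (j : Fin 6) (x : UnitAddTorus (Fin 3)) (a b : Fin 3) :
    I.Rtensor k j x a b = I.Rtensor k j x b a :=
  kernel_dTensor_symm (h.isSmooth_apsi k j) (h.ℓ_pos k) (h.ℓ_le k) x a b

/-- `heatDefectTensor` is symmetric. [cite: CoiculescuPalasek2025, Prop. 4.1 (`F ∈ S^{3×3}`)] -/
theorem heatDefectTensor_symm (k : ℕ) (j : Fin 6) (x : UnitAddTorus (Fin 3)) (a b : Fin 3) :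
    I.heatDefectTensor k j x a b = I.heatDefectTensor k j x b a :=
  kernel_dTensor_symm (h.isSmooth_heatDefect k j) (h.ℓ_pos k) (h.ℓ_le k) x a b

/-- **`F₁` at level `k` is symmetric.** [cite: CoiculescuPalasek2025, Prop. 4.1] -/
theorem heatResidual_symm (k : ℕ) (t : ℝ) (x : UnitAddTorus (Fin 3)) (a b : Fin 3) :
    I.heatResidual k t x a b = I.heatResidual k t x b a := by
  simp only [heatResidual, Pi.neg_apply, Finset.sum_apply, Pi.smul_apply, smul_eq_mul]
  congr 1
  refine Finset.sum_congr rfl fun j _ => ?_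
  rw [h.heatDefectTensor_symm k j x a b]

/-! ### The identities -/

/-- **`V_{j,k} = div (k_ℓ ⋆ 𝒟(a_{j,k}Ψ⁰_{j,k}))`.** [cite: CoiculescuPalasek2025, Rmk. 3.11 and Prop. 4.1 ("`ℙ div R_k = v_k`")] -/
theorem Vfield_eq_tensorDiv_Rtensor (k : ℕ) (j : Fin 6) : I.Vfield k j = tensorDiv (I.Rtensor k j) := by
  rw [Vfield, Rtensor, tensorDiv_kernel_dTensor (h.isSmooth_apsi k j) (h.ℓ_pos k) (h.ℓ_le k)]
  rfl

/-- **`v_k(t) = div R_k(t)`** (exactly). [cite: CoiculescuPalasek2025, Prop. 4.1 ("`ℙ div R_k = v_k`")] -/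
theorem vHeat_eq_tensorDiv_Rheat (k : ℕ) (t : ℝ) (x : UnitAddTorus (Fin 3)) :
    I.vHeat k t x = tensorDiv (I.Rheat k t) x := by
  have hs : ∀ j ∈ (Finset.univ : Finset (Fin 6)), IsSmooth (I.Rtensor k j) := fun j _ => h.isSmooth_Rtensor k j
  have hfun : I.Rheat k t = fun y a b => ∑ j ∈ Finset.univ, Real.exp (-(I.rate k j * t)) * I.Rtensor k j y a b := by
    funext y a b; simp [Rheat, Finset.sum_apply, Pi.smul_apply, smul_eq_mul]
  rw [hfun, tensorDiv_finset_sum_smul Finset.univ _ hs x]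
  simp only [vHeat, h.Vfield_eq_tensorDiv_Rtensor]

/-- `curl curl (heatDefect) = -rate · curl curl (aΨ⁰) - Δ(curl curl (aΨ⁰))`. [folklore] -/
theorem curl_curl_heatDefect (k : ℕ) (j : Fin 6) (x : UnitAddTorus (Fin 3)) :
    BDSV.curl (BDSV.curl (I.heatDefect k j)) x =
      -(I.rate k j) • BDSV.curl (BDSV.curl (I.apsi k j)) x - Torus.laplacian (BDSV.curl (BDSV.curl (I.apsi k j))) x := by
  have ha := h.isSmooth_apsi k j
  have hL := ha.laplacian
  have h1 : IsContDiff 1 (fun y => -(I.rate k j) • I.apsi k j y) := (ha.smul _).isContDiff (by simp)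
  have h2 : IsContDiff 1 (Torus.laplacian (I.apsi k j)) := hL.isContDiff (by simp)
  have hfun : I.heatDefect k j = (fun y => -(I.rate k j) • I.apsi k j y) - Torus.laplacian (I.apsi k j) := rfl
  rw [hfun, show BDSV.curl ((fun y => -(I.rate k j) • I.apsi k j y) - Torus.laplacian (I.apsi k j)) =
      fun y => BDSV.curl (fun y => -(I.rate k j) • I.apsi k j y) y - BDSV.curl (Torus.laplacian (I.apsi k j)) y from
      funext fun y => BDSV.curl_sub h1 h2 y]
  have h1' : IsContDiff 1 (BDSV.curl fun y => -(I.rate k j) • I.apsi k j y) := (BDSV.isSmooth_curl (ha.smul _)).isContDiff (by simp)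
  have h2' : IsContDiff 1 (BDSV.curl (Torus.laplacian (I.apsi k j))) := (BDSV.isSmooth_curl hL).isContDiff (by simp)
  rw [show (fun y => BDSV.curl (fun y => -(I.rate k j) • I.apsi k j y) y - BDSV.curl (Torus.laplacian (I.apsi k j)) y) =
      BDSV.curl (fun y => -(I.rate k j) • I.apsi k j y) - BDSV.curl (Torus.laplacian (I.apsi k j)) from rfl,
    BDSV.curl_sub h1' h2']
  -- the scalar factor
  have hsm : (fun y => -(I.rate k j) • I.apsi k j y) = (-(I.rate k j)) • I.apsi k j := rfl
  have hc1 : BDSV.curl (fun y => -(I.rate k j) • I.apsi k j y) = fun y => (-(I.rate k j)) • BDSV.curl (I.apsi k j) y := by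
    funext y; rw [hsm, BDSV.curl_const_smul (ha.isContDiff (by simp))]
  have hc1' : BDSV.curl (BDSV.curl fun y => -(I.rate k j) • I.apsi k j y) x = (-(I.rate k j)) • BDSV.curl (BDSV.curl (I.apsi k j)) x := by
    rw [hc1, show (fun y => -I.rate k j • BDSV.curl (I.apsi k j) y) = (-(I.rate k j)) • BDSV.curl (I.apsi k j) from rfl,
      BDSV.curl_const_smul ((BDSV.isSmooth_curl ha).isContDiff (by simp))]
  rw [hc1', show Torus.laplacian (I.apsi k j) = fun y => Torus.laplacian (I.apsi k j) y from rfl, ← laplacian_curl_curl ha x]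

/-- **`div (k_ℓ ⋆ 𝒟 heatDefect_{j,k}) = -rate_{k,j} V_{j,k} - Δ V_{j,k}`.** [cite: CoiculescuPalasek2025, Prop. 4.1 (proof)] -/
theorem tensorDiv_heatDefectTensor (k : ℕ) (j : Fin 6) (x : UnitAddTorus (Fin 3)) :
    tensorDiv (I.heatDefectTensor k j) x = -(I.rate k j) • I.Vfield k j x - Torus.laplacian (I.Vfield k j) x := by
  have ha := h.isSmooth_apsi k j
  have hcc : IsSmooth (BDSV.curl (BDSV.curl (I.apsi k j))) := BDSV.isSmooth_curl (BDSV.isSmooth_curl ha)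
  have hκi := (isSmooth_kernel (d := Fin 3) (h.ℓ_pos k) (h.ℓ_le k)).integrable
  rw [heatDefectTensor, tensorDiv_kernel_dTensor (h.isSmooth_heatDefect k j) (h.ℓ_pos k) (h.ℓ_le k)]
  have hfun : BDSV.curl (BDSV.curl (I.heatDefect k j)) =
      fun y => (-(I.rate k j)) • BDSV.curl (BDSV.curl (I.apsi k j)) y + (-1 : ℝ) • Torus.laplacian (BDSV.curl (BDSV.curl (I.apsi k j))) y := by
    funext y; rw [h.curl_curl_heatDefect k j y]; simp [sub_eq_add_neg]
  rw [hfun]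
  -- convolution is linear and commutes with `Δ`
  set CC := BDSV.curl (BDSV.curl (I.apsi k j)) with hCC
  have hA : Continuous fun y => (-(I.rate k j)) • CC y := (hcc.smul _).continuous
  have hB : Continuous fun y => (-1 : ℝ) • Torus.laplacian CC y := (hcc.laplacian.smul _).continuous
  rw [show (fun y => (-(I.rate k j)) • CC y + (-1 : ℝ) • Torus.laplacian CC y) =
      (fun y => (-(I.rate k j)) • CC y) + (fun y => (-1 : ℝ) • Torus.laplacian CC y) from rfl,
    ConvolutionExistsAt.distrib_add (FunctionSpaces.Torus.convolutionExistsAt_of_continuous _ hκi hA x)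
      (FunctionSpaces.Torus.convolutionExistsAt_of_continuous _ hκi hB x),
    show (fun y => (-(I.rate k j)) • CC y) = (-(I.rate k j)) • CC from rfl, convolution_smul,
    show (fun y => (-1 : ℝ) • Torus.laplacian CC y) = (-1 : ℝ) • Torus.laplacian CC from rfl, convolution_smul,
    Pi.smul_apply, Pi.smul_apply, ← FunctionSpaces.Torus.laplacian_convolution hκi hcc x]
  simp only [Vfield, hCC, neg_smul, one_smul, sub_eq_add_neg]
  rfl

/-- `Δ v_k(t) = ∑_j e^{-rate t} ΔV_{j,k}`. [folklore] -/
theorem laplacian_vHeat (k : ℕ) (t : ℝ) (x : UnitAddTorus (Fin 3)) :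
    Torus.laplacian (I.vHeat k t) x = ∑ j, Real.exp (-(I.rate k j * t)) • Torus.laplacian (I.Vfield k j) x := by
  rw [show I.vHeat k t = fun y => ∑ j ∈ Finset.univ, Real.exp (-(I.rate k j * t)) • I.Vfield k j y from rfl,
    laplacian_finset_sum_smul Finset.univ _ (fun j _ => h.isSmooth_Vfield k j) x]

/-- **`div (heatResidual k t) = -(∂ₜ v_k(t) - Δ v_k(t))`** with `∂ₜ v_k(t) = ∑_j (-rate e^{-rate t}) V_{j,k}`.
[cite: CoiculescuPalasek2025, Prop. 4.1 ("`-ℙ div F₁ = ∑(∂ₜ - Δ) v_k`")] -/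
theorem tensorDiv_heatResidual (k : ℕ) (t : ℝ) (x : UnitAddTorus (Fin 3)) :
    tensorDiv (I.heatResidual k t) x =
      -((∑ j, (-(I.rate k j) * Real.exp (-(I.rate k j * t))) • I.Vfield k j x) - Torus.laplacian (I.vHeat k t) x) := by
  have hs : ∀ j ∈ (Finset.univ : Finset (Fin 6)), IsSmooth (I.heatDefectTensor k j) := fun j _ => h.isSmooth_heatDefectTensor k j
  have hneg : I.heatResidual k t = fun y a b => ∑ j ∈ Finset.univ, (-Real.exp (-(I.rate k j * t))) * I.heatDefectTensor k j y a b := by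
    funext y a b
    simp only [heatResidual, Pi.neg_apply, Finset.sum_apply, Pi.smul_apply, smul_eq_mul, ← Finset.sum_neg_distrib, neg_mul]
  rw [hneg, tensorDiv_finset_sum_smul Finset.univ _ hs x, h.laplacian_vHeat, ← Finset.sum_sub_distrib, ← Finset.sum_neg_distrib]
  refine Finset.sum_congr rfl fun j _ => ?_
  rw [h.tensorDiv_heatDefectTensor]
  module

end Admissible

end IterData


end CP25

end Literature.Analysis.FluidPDE
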